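import Summits.BirchSwinnertonDyer.BirchSwinnertonDyer.Theses.ThetaPartnerAtTwo
import Summits.BirchSwinnertonDyer.BirchSwinnertonDyer.Theorems.ThetaPartnerAtTwoSignedMainConjectureCMTwoRankZero
import HarnessLib

/-! # Skeleton line `rankzero` — crux K2 `SignedMainConjectureCMTwo` (route ThetaPartnerAtTwo rev 7,
item stmt-BirchSwinnertonDyer-20307; prover bsd-wall-tp2-p2 g1, 2026-08-27)

Supersedes the birth skeleton (stubs `stub_cmSignedStructureTwo` / `stub_cmSignedMainConjectureTwo` =
the crux's two conjuncts restated). Cut along the LANDED rank-zero rigidity file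
`Theorems/ThetaPartnerAtTwoSignedMainConjectureCMTwoRankZero.lean` (p518019;
`signedMainConjectureCMTwo_at_rankZero_of_lowerDivisibility`): at a CM curve `A` of ANALYTIC RANK 0 —
the only case the route's `closes` consumes (kernel certificate p518558
`nonCMAtTwo_of_signedMainConjectureCMTwo_rankZero`) — BSD₂(A) (Burungale–Flach, PUB) pins the constant
term of every generator of `char X⁺(A/ℚ_∞)`, so ONE divisibility at `2` is the whole `+` main
conjecture and `μ⁺ = 0` is the analytic `μ`. Stubs (all at `p = 2`; sizes are guesses):
* `stub_torsionCMTwo`      (T2_A)  Kobayashi Thm 1.2 torsion half at `2` for CM rank-0 `A` (size L; for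
  rank 0 reducible to bottom-layer signed control `Sel⁺(A/ℚ_∞)^Γ` finite via the tree theorem
  `SignedSelmerDualData.isTorsion_of_finite_endInvariants` — same open input as 19097 / 20333 stub_torsion2);
* `stub_kimControlCMTwo`   (K4c_A) B. D. Kim 2013 Cor 3.15 at `2`, read for CM rank-0 `A` (= crux K4c
  `SignedControlAtTwo` conjunct 2 with `¬HasCM` replaced by `HasCM`; size M);
* `stub_lowerDivisibilityCMTwo` (E_A) the EISENSTEIN HALF `KobayashiLowerDivisibility A 2 1` (tree def)
  for CM rank-0 `A`: `char X⁺ = (g)`, `ι g = ϖ·ι(L♭·h)` — Rubin/elliptic-unit side at INERT 2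
  (size L, LOAD-BEARING; Pollack–Rubin 2004 §§4–7 at p = 2; unprinted);
* `stub_analyticMuCMTwo`   (μan_A) `ord₂ ϖ_A = 0` and Kobayashi's `L⁺ = L♭_A` has a unit coefficient
  (analytic `μ = 0`; KO2006 Rem 0.2(3) for X₀(27); kit j273215 numerics on 25 anchors; size M);
* `stub_generatorChangeCMTwo` (GC) `μ⁺ = 0` passes from normalised cyclotomic pairs
  (`IsCyclotomicVariable 2 γ`) to all top-generator pairs — signed copy of the tree's
  `IwasawaGeneratorChangeProofs` (PROVABLE infrastructure, size M; mooted if the planner adds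
  `IsCyclotomicVariable 2 γ →` to the crux's first conjunct, which is all K1's bridge consumes);
* `stub_positiveRankCMTwo` (posRank) the crux verbatim for CM `A` with `A.analyticRank ≠ 0` — NOT used
  by `closes` (p518558); mooted if the planner restates K2 with `A.analyticRank = 0 →` (size XL: no
  `T = 0` anchor, Pollack pair at 2 not tree-exhibitable when `L(A,1) = 0`);
* `stub_publishedInputsCMTwo` (PUB) Burungale–Flach 2024 / modularity / GZK, BY NAME (cite-only).
The composition `SignedMainConjectureCMTwo_of` is kernel-checked (no sorry of its own).
-/

set_option autoImplicit false
set_option linter.dupNamespace false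

noncomputable section

open scoped Classical MatrixGroups ModularForm

open CongruenceSubgroup WeierstrassCurve Literature Literature.NumberTheory.EllipticCurves
  Literature.NumberTheory.EllipticCurves.ModularForms
  Literature.NumberTheory.EllipticCurves.Rank1Residual
  Literature.NumberTheory.EllipticCurves.Kobayashi2003 ZpExtension
  Summit.BirchSwinnertonDyer.Rank1Residual.Supersingular

namespace Summit.BirchSwinnertonDyer.BirchSwinnertonDyer.Cruxes.SignedMainConjectureCMTwo.RankZero

/-- (T2_A) Kobayashi Thm. 1.2, torsion half, at `p = 2`, for CM curves of analytic rank `0`. -/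
theorem stub_torsionCMTwo :
    ∀ (A : WeierstrassCurve ℚ) [A.IsElliptic] [A.IsGloballyMinimal],
      A.HasCM → A.analyticRank = 0 → GoodSS A 2 → A.frobeniusTrace 2 = 0 →
      ∀ (κ : ZpExtension ℚ 2) (γ : Field.absoluteGaloisGroup ℚ), κ.IsCyclotomic → κ.IsTopGenerator γ →
      ∀ D : SignedSelmerDualData A κ γ 1, Module.IsTorsion (IwasawaAlgebra 2) D.X := by
  sorry

/-- (K4c_A) B. D. Kim 2013 Cor. 3.15 at `2`, read for CM curves of analytic rank `0`. -/
theorem stub_kimControlCMTwo :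
    ∀ (A : WeierstrassCurve ℚ) [A.IsElliptic] [A.IsGloballyMinimal],
      A.HasCM → A.analyticRank = 0 → GoodSS A 2 → A.frobeniusTrace 2 = 0 →
      ∀ (κ : ZpExtension ℚ 2) (γ : Field.absoluteGaloisGroup ℚ), κ.IsCyclotomic → κ.IsTopGenerator γ →
      ∀ (D : SignedSelmerDualData A κ γ 1) [Module.Finite (IwasawaAlgebra 2) D.X],
        Module.IsTorsion (IwasawaAlgebra 2) D.X →
      ∀ g : IwasawaAlgebra 2, D.charIdeal = Ideal.span {g} → Finite (A.selmerGroupPInfty 2) →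
        ∃ u : ℤ_[2]ˣ, ((PowerSeries.constantCoeff g : ℤ_[2]) : ℚ_[2]) =
          ((u : ℤ_[2]) : ℚ_[2]) * ((2 : ℕ) : ℚ_[2]) ^ (padicValNat 2 A.tamagawaProduct) *
            (Nat.card (A.selmerGroupPInfty 2) : ℚ_[2]) := by
  sorry

/-- (E_A) The Eisenstein half of Kobayashi's `+` main conjecture at `2` for CM curves of analytic rank
`0` (the tree's typed `KobayashiLowerDivisibility A 2 1`). LOAD-BEARING. -/
theorem stub_lowerDivisibilityCMTwo :
    ∀ (A : WeierstrassCurve ℚ) [A.IsElliptic] [A.IsGloballyMinimal],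
      A.HasCM → A.analyticRank = 0 → GoodSS A 2 → A.frobeniusTrace 2 = 0 →
      KobayashiLowerDivisibility A 2 1 := by
  sorry

/-- (μan_A) Analytic `μ = 0` at `2` for CM newforms of analytic rank `0`: the period ratio is a `2`-adic
unit and Kobayashi's `L⁺ = L♭` has a unit coefficient. -/
theorem stub_analyticMuCMTwo :
    ∀ (A : WeierstrassCurve ℚ) [A.IsElliptic] [A.IsGloballyMinimal],
      A.HasCM → A.analyticRank = 0 → GoodSS A 2 → A.frobeniusTrace 2 = 0 →
      ∀ [NeZero (A.conductorNorm ℤ)] (f : CuspForm (Gamma0 (A.conductorNorm ℤ)) 2),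
      IsNewformOf A f → ∀ (ϖ : ℚ), (ϖ : ℝ) * A.realPeriodRat = plusPeriod f →
      ∀ (Lplus Lminus : IwasawaAlgebra 2), IsPollackPair f 2 Lplus Lminus →
        padicValRat 2 ϖ = 0 ∧ ∃ n : ℕ, IsUnit (PowerSeries.coeff n (kobayashiL 1 Lplus Lminus)) := by
  sorry

/-- (GC) Signed generator change for `μ⁺ = 0` (normalised pairs ⇒ all top-generator pairs). PROVABLE
infrastructure (unsigned version: `IwasawaGeneratorChangeProofs`). -/
theorem stub_generatorChangeCMTwo :
    ∀ (A : WeierstrassCurve ℚ) [A.IsElliptic] [A.IsGloballyMinimal],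
      A.HasCM → A.analyticRank = 0 → GoodSS A 2 → A.frobeniusTrace 2 = 0 →
      (∀ (κ : ZpExtension ℚ 2) (γ : Field.absoluteGaloisGroup ℚ),
        κ.IsCyclotomic → κ.IsTopGenerator γ → IsCyclotomicVariable 2 γ →
        ∀ D : SignedSelmerDualData A κ γ 1, D.mu = 0) →
      ∀ (κ : ZpExtension ℚ 2) (γ : Field.absoluteGaloisGroup ℚ), κ.IsCyclotomic → κ.IsTopGenerator γ →
      ∀ D : SignedSelmerDualData A κ γ 1, D.mu = 0 := by
  sorry

/-- (posRank) The crux verbatim at CM curves of POSITIVE analytic rank — not consumed by the route's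
`closes` (p518558); mooted by a rank-`0` restatement of K2. -/
theorem stub_positiveRankCMTwo :
    ∀ (A : WeierstrassCurve ℚ) [A.IsElliptic] [A.IsGloballyMinimal],
      A.HasCM → A.analyticRank ≠ 0 → GoodSS A 2 → A.frobeniusTrace 2 = 0 →
      (∀ (κ : ZpExtension ℚ 2) (γ : Field.absoluteGaloisGroup ℚ),
        κ.IsCyclotomic → κ.IsTopGenerator γ →
        ∀ D : SignedSelmerDualData A κ γ 1, Module.IsTorsion (IwasawaAlgebra 2) D.X ∧ D.mu = 0) ∧
      KobayashiMainConjecture A 2 1 := by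
  sorry

/-- (PUB) The published inputs, BY NAME (cite-only): Burungale–Flach 2024 (BSD for CM curves with
`L(E,1) ≠ 0` at every prime), modularity (parametrisation data; entire `L`), Gross–Zagier–Kolyvagin. -/
theorem stub_publishedInputsCMTwo :
    bsdTriple_of_hasCM_of_L_one_ne_zero ∧ nonempty_modularParametrizationData ∧
      hasEntireLFunction_rat ∧ rank_eq_analyticRank_of_analyticRank_le_one := by
  sorry

/-- COMPOSITION (kernel-checked, no sorry of its own): the stubs give the crux BY NAME — at analytic
rank `0` through the landed `signedMainConjectureCMTwo_at_rankZero_of_lowerDivisibility` (p518019),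
at positive rank through `stub_positiveRankCMTwo`. -/
theorem SignedMainConjectureCMTwo_of :
    Summit.BirchSwinnertonDyer.BirchSwinnertonDyer.Theses.ThetaPartnerAtTwo.SignedMainConjectureCMTwo := by
  intro A _ _ hcm hss ha
  obtain ⟨hBF, hmod, hLrat, hGZK⟩ := stub_publishedInputsCMTwo
  by_cases hr : A.analyticRank = 0
  · obtain ⟨hMC, hnorm⟩ :=
      Summit.BirchSwinnertonDyer.BirchSwinnertonDyer.Theorems.signedMainConjectureCMTwo_at_rankZero_of_lowerDivisibility
        A hBF hmod hLrat hGZK hcm hss ha hr (stub_torsionCMTwo A hcm hr hss ha)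
        (stub_kimControlCMTwo A hcm hr hss ha) (stub_lowerDivisibilityCMTwo A hcm hr hss ha)
        (stub_analyticMuCMTwo A hcm hr hss ha)
    refine ⟨fun κ γ hκ hγ D => ⟨stub_torsionCMTwo A hcm hr hss ha κ γ hκ hγ D, ?_⟩, hMC⟩
    exact stub_generatorChangeCMTwo A hcm hr hss ha
      (fun κ₀ γ₀ hκ₀ hγ₀ hγ₀' D₀ => (hnorm κ₀ γ₀ hκ₀ hγ₀ hγ₀' D₀).2) κ γ hκ hγ D
  · exact stub_positiveRankCMTwo A hcm hr hss ha

end Summit.BirchSwinnertonDyer.BirchSwinnertonDyer.Cruxes.SignedMainConjectureCMTwo.RankZero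

end
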